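import Summits.BirchSwinnertonDyer.BirchSwinnertonDyer.Theorems.EisensteinDepletionAtTwoStarGO2KEtaHondaPointB
import Summits.BirchSwinnertonDyer.BirchSwinnertonDyer.Theorems.EisensteinDepletionAtTwoStarGO2KEtaThetaPattern
import Summits.BirchSwinnertonDyer.BirchSwinnertonDyer.Theorems.EisensteinDepletionAtTwoStarGO2KEtaSqrtCriterion
import Literature.NumberTheory.EllipticCurves.RationalTwoTorsionConductorExponentProofs
import HarnessLib

/-!
# Line `kummer` v7.2, stub K-Θ `stub_etaKummerTheta` FROM the elementary parity stub KA (crux `StarGO2Sigma`,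
# stmt-BirchSwinnertonDyer-27046; lead bsd-rank2-star-p1 GEN 13, porting planner p2 GEN 38's sketch glue)

THE ETA–KUMMER SQUARE LAW `Θ_N·(X(Z_c) − x₀Z_c²) = R²` (stub K-Θ, corrected v7.2 form) from
* K1 THEOREM K AT THE HONDA POINT (tree, `KEta.HondaPoint.kummerClassLaw_hondaPoint_of_rationalTwoTorsion`):
  `U² − U(q²)(1 + 2cG) ∈ 4ℤ⟦q⟧`, `U = X(Z_c) − x₀Z_c²`, `G` the class pattern;
* KF (tree, `KEta.EulerClassLaw.eulerClassLaw`) ⟹ `Θ_N² − Θ_N(q²)(1 + 2θ_T) ∈ 4ℤ⟦q⟧` (`thetaClassLaw`);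
* KΘp (tree, `KEta.ThetaPattern.thetaPatternParity`) + **KA (hypothesis; the one elementary stub left)** ⟹ the Eisenstein
  congruence `cG ≡ θ_T (mod 2)` for odd `c` (`pattern_congr`);
* Kalg `criterion_mul` ⟹ `P = Θ_N·U` satisfies `P² ≡ P(q²) (mod 4)`; K√ (tree, `KEta.SqrtCriterion.sqrtCriterion`) ⟹ `P = R²`.
The glue lemmas are planner p2 GEN 38's (HOME/p2/g38/lean/KummerV7Sketch.lean §4, kernel-checked there), moved to the tree.
Nothing here reads `r_an`; `StarGO2Sigma` / E1M / BSD are NOT proved by this file.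
-/

set_option linter.dupNamespace false
set_option autoImplicit false

noncomputable section

open PowerSeries
open Literature.NumberTheory.EllipticCurves Literature.NumberTheory.EllipticCurves.Greenberg1999
open Literature.NumberTheory.EllipticCurves.ModularForms
open Summit.BirchSwinnertonDyer.BirchSwinnertonDyer.Theorems.DepletionAtTwo
open Summit.BirchSwinnertonDyer.BirchSwinnertonDyer.Theorems.DepletionAtTwo.KEta

namespace Summit.BirchSwinnertonDyer.BirchSwinnertonDyer.Theorems.DepletionAtTwo.KummerSigma.ThetaLaw

/-! ### §1 Glue (planner p2 GEN 38, KummerV7Sketch §4) -/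

/-- `4 = C 4` in `ℤ⟦q⟧`. [folklore] -/
theorem C_four : (4 : PowerSeries ℤ) = C (4 : ℤ) := (map_ofNat C 4).symm

/-- `2 = C 2` in `ℤ⟦q⟧`. [folklore] -/
theorem C_two : (2 : PowerSeries ℤ) = C (2 : ℤ) := (map_ofNat C 2).symm

/-- `∀ n, 2 ∣ [qⁿ]E` packages as `E = 2F`. [folklore] -/
theorem exists_eq_two_mul {E : PowerSeries ℤ} (h : ∀ n : ℕ, (2 : ℤ) ∣ coeff n E) : ∃ F : PowerSeries ℤ, E = 2 * F := by
  choose g hg using h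
  refine ⟨PowerSeries.mk g, PowerSeries.ext fun n => ?_⟩
  rw [C_two, coeff_C_mul, coeff_mk]
  exact hg n

/-- Kalg — THE PRODUCT OF TWO CLASS LAWS: if `g² = g(q²)(1 + 2A) + 4E₁`, `U² = U(q²)(1 + 2B) + 4E₂` and `B ≡ A (mod 2)`,
then `P = gU` satisfies the square criterion `P² ≡ P(q²) (mod 4)`. [folklore] -/
theorem criterion_mul {g U A B E₁ E₂ D : PowerSeries ℤ}
    (hg : g ^ 2 - expand 2 two_ne_zero g * (1 + 2 * A) = 4 * E₁)
    (hU : U ^ 2 - expand 2 two_ne_zero U * (1 + 2 * B) = 4 * E₂) (hD : B - A = 2 * D) :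
    (g * U) ^ 2 - expand 2 two_ne_zero (g * U) =
      4 * (expand 2 two_ne_zero g * expand 2 two_ne_zero U * (D + A + A * B) + E₁ * U ^ 2 +
        expand 2 two_ne_zero g * (1 + 2 * A) * E₂) := by
  rw [map_mul]
  linear_combination U ^ 2 * hg + expand 2 two_ne_zero g * (1 + 2 * A) * hU +
    2 * expand 2 two_ne_zero g * expand 2 two_ne_zero U * hD

/-- THE PRODUCT RULE for class laws: patterns ADD. [folklore] -/
theorem classLaw_mul {g h A B : PowerSeries ℤ}
    (hg : ∀ n : ℕ, (4 : ℤ) ∣ coeff n (g ^ 2 - expand 2 two_ne_zero g * (1 + 2 * A)))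
    (hh : ∀ n : ℕ, (4 : ℤ) ∣ coeff n (h ^ 2 - expand 2 two_ne_zero h * (1 + 2 * B))) :
    ∀ n : ℕ, (4 : ℤ) ∣ coeff n ((g * h) ^ 2 - expand 2 two_ne_zero (g * h) * (1 + 2 * (A + B))) := by
  obtain ⟨E₁, hE₁⟩ := SqrtCriterion.exists_eq_four_mul hg
  obtain ⟨E₂, hE₂⟩ := SqrtCriterion.exists_eq_four_mul hh
  have key : (g * h) ^ 2 - expand 2 two_ne_zero (g * h) * (1 + 2 * (A + B)) =
      4 * (expand 2 two_ne_zero g * expand 2 two_ne_zero h * (A * B) + E₁ * h ^ 2 +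
        expand 2 two_ne_zero g * (1 + 2 * A) * E₂) := by
    rw [map_mul]
    linear_combination h ^ 2 * hE₁ + expand 2 two_ne_zero g * (1 + 2 * A) * hE₂
  intro n
  rw [key, C_four, coeff_C_mul]
  exact dvd_mul_right _ _

/-- KF ⟹ THE CLASS LAW OF `Θ_N`: `Θ_N² − Θ_N(q²)(1 + 2θ_T) ∈ 4ℤ⟦q⟧` (Finset induction with `classLaw_mul` over the
tree's `eulerClassLaw`). [cite: Apostol1990, §3.1–3.2] -/
theorem thetaClassLaw (N : ℕ) :
    ∀ n : ℕ, (4 : ℤ) ∣ coeff n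
      (kummerThetaSeries N ^ 2 - expand 2 two_ne_zero (kummerThetaSeries N) * (1 + 2 * ThetaPattern.thetaPattern N)) := by
  classical
  rw [kummerThetaSeries, ThetaPattern.thetaPattern]
  induction kummerThetaDivisors N using Finset.induction_on with
  | empty => simp
  | insert a s ha ih =>
    rw [Finset.prod_insert ha, Finset.sum_insert ha]
    exact classLaw_mul (EulerClassLaw.eulerClassLaw a) ih

/-- `LevelPattern N 0` is false. [folklore] -/
theorem not_levelPattern_zero (N : ℕ) : ¬ ThetaPattern.LevelPattern N 0 := fun h => h.1 rfl

/-- Kpat — THE EISENSTEIN CONGRUENCE `m·G ≡ θ_T (mod 2)` from the two parity patterns (KA at the odd part, KΘp) and `m` odd.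
[cite: Stevens1982, §2.4 (PDF pp. 35–37)] -/
theorem pattern_congr {N : ℕ} {a : ℕ → ℤ} {Gη : PowerSeries ℤ} {m : ℤ} (hm : Odd m)
    (hA : ∀ n : ℕ, ¬ 2 ∣ n → (Odd (a n) ↔ ThetaPattern.LevelPattern N n))
    (hη : ∀ n : ℕ, Odd (coeff n Gη) ↔ (Even (n.factorization 2) ∧ ThetaPattern.LevelPattern N (n / 2 ^ n.factorization 2))) :
    ∀ n : ℕ, (2 : ℤ) ∣ coeff n (C m * HondaPoint.patSeries a - Gη) := by
  intro n
  rw [map_sub, coeff_C_mul, HondaPoint.coeff_patSeries, ← even_iff_two_dvd, Int.even_sub]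
  have key : Odd (m * (if n = 0 then 0 else if Even (n.factorization 2) then a (n / 2 ^ n.factorization 2) else 0)) ↔
      Odd (coeff n Gη) := by
    rw [Int.odd_mul, hη]
    by_cases hn : n = 0
    · subst hn
      simp [not_levelPattern_zero]
    · rw [if_neg hn]
      by_cases he : Even (n.factorization 2)
      · rw [if_pos he, hA _ (Nat.not_dvd_ordCompl Nat.prime_two hn)]
        exact ⟨fun h => ⟨he, h.2⟩, fun h => ⟨hm, h.2⟩⟩
      · rw [if_neg he]
        simp [he]
  rcases Int.even_or_odd (coeff n Gη) with h | h
  · exact ⟨fun _ => h, fun _ => by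
      rw [← Int.not_odd_iff_even] at h ⊢
      exact fun h' => h (key.mp h')⟩
  · exact ⟨fun h' => absurd (key.mpr h) (Int.not_odd_iff_even.mpr h'), fun h' => absurd h (Int.not_odd_iff_even.mpr h')⟩

/-! ### §2 K-Θ from KA -/

/-- **Stub K-Θ `stub_etaKummerTheta` (v7.2 form) from the elementary parity stub KA.**  For `W₀/ℚ` globally minimal and
ordinary at `2` with an étale rational `2`-torsion abscissa `x₀` and every odd `c`: `Θ_N·(X(Z_c) − x₀Z_c²)` is the square of an
integral series with constant term `1`, GRANTED KA «for odd `n`, `a_n(W₀)` is odd iff `LevelPattern N_{W₀} n`».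
[cite: Honda1968, Thm. 5] [cite: SilvermanAEC2009, IV.1] -/
theorem etaKummerTheta_of_apParityPattern
    (KA : ∀ (W₀ : WeierstrassCurve ℚ) [W₀.IsElliptic] [W₀.IsGloballyMinimal] (x₀ : ℚ), HasRationalTwoTorsionX W₀ x₀ →
      ∀ n : ℕ, ¬ 2 ∣ n → (Odd (W₀.LFunction n) ↔ ThetaPattern.LevelPattern (W₀.conductorNorm ℤ) n)) :
    ∀ (W₀ : WeierstrassCurve ℚ) [W₀.IsElliptic] [W₀.IsGloballyMinimal], IsOrdinaryAt W₀ 2 →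
      ∀ (x₀ : ℚ), HasRationalTwoTorsionX W₀ x₀ → ¬ TwoTorsionRamifiedAtTwo x₀ →
      ∀ (c : ℤ), Odd c →
      ∃ R : PowerSeries ℤ, PowerSeries.constantCoeff R = 1 ∧
        PowerSeries.map (Int.castRingHom ℚ) (kummerThetaSeries (W₀.conductorNorm ℤ)) *
            (W₀.formalXMulSq - PowerSeries.C x₀ * PowerSeries.X ^ 2).subst
              (W₀.formalExp.subst ((c : ℚ) • (PowerSeries.mk fun j : ℕ ↦ ((W₀.LFunction j : ℤ) : ℚ) / j))) =
          PowerSeries.map (Int.castRingHom ℚ) R ^ 2 := by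
  intro W₀ _ _ hord x₀ hx hv c hc
  haveI : Fact (Nat.Prime 2) := ⟨Nat.prime_two⟩
  set N : ℕ := W₀.conductorNorm ℤ with hNdef
  -- `N` is odd with all exponents `≤ 2`
  have hNodd : Odd N := by
    rw [← Nat.not_even_iff_odd, even_iff_two_dvd, hNdef]
    exact fun h => ((W₀.dvd_conductorNorm_iff_not_hasGoodReductionAtPrime 2).mp h) hord.1
  have hle2 : ∀ p ∈ N.primeFactors, N.factorization p ≤ 2 := by
    intro p hp
    haveI : Fact p.Prime := ⟨Nat.prime_of_mem_primeFactors hp⟩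
    by_cases hp2 : p = 2
    · subst hp2
      rw [Nat.factorization_eq_zero_of_not_dvd fun h => (Nat.not_even_iff_odd.mpr hNodd) (even_iff_two_dvd.mpr h)]
      exact Nat.zero_le _
    · exact factorization_conductorNorm_le_two_of_ne_two_of_hasRationalTwoTorsionX W₀ p hp2 hx
  -- the Honda-point series `U` and its integral model
  have hpar : W₀.formalExp.subst ((c : ℚ) • (PowerSeries.mk fun j : ℕ ↦ ((W₀.LFunction j : ℤ) : ℚ) / j)) =
      HondaPoint.param W₀ c := rfl
  rw [hpar, HondaPoint.subst_formalXMulSq_sub W₀ x₀ (HondaPoint.hasSubst_param W₀ c)]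
  obtain ⟨m, hm⟩ := HondaPoint.exists_int_eq_of_twoTorsionX (WeierstrassCurve.integralModelInt W₀)
    (by rwa [WeierstrassCurve.map_integralModelInt]) hv
  obtain ⟨Uℤ, hUℤ⟩ := HondaPoint.exists_int_hondaU W₀ m c
  rw [hm] at hUℤ
  have hU1 := HondaPoint.constantCoeff_hondaU W₀ x₀ c
  -- K1: the class law of `U` over `ℤ`
  have hEℤ : ∀ n : ℕ, (4 : ℤ) ∣ coeff n
      (Uℤ ^ 2 - expand 2 two_ne_zero Uℤ * (1 + 2 * (C c * HondaPoint.classPattern W₀))) := by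
    intro n
    obtain ⟨kk, hkk⟩ := HondaPoint.kummerClassLaw_hondaPoint_of_rationalTwoTorsion W₀ hord hx hv c n
    have hmap : (Uℤ ^ 2 - expand 2 two_ne_zero Uℤ * (1 + 2 * (C c * HondaPoint.classPattern W₀))).map (Int.castRingHom ℚ) =
        (W₀.formalXMulSq.subst (HondaPoint.param W₀ c) - C x₀ * HondaPoint.param W₀ c ^ 2) ^ 2 -
          expand 2 two_ne_zero (W₀.formalXMulSq.subst (HondaPoint.param W₀ c) - C x₀ * HondaPoint.param W₀ c ^ 2) *
            (1 + 2 * C (c : ℚ) * (HondaPoint.classPattern W₀).map (Int.castRingHom ℚ)) := by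
      rw [map_sub, map_pow, map_mul, map_expand, hUℤ, map_add, map_one, map_mul, map_mul, map_ofNat, map_C,
        eq_intCast, mul_assoc]
    have h := congrArg (coeff n) hmap
    rw [coeff_map, eq_intCast, hkk] at h
    exact ⟨kk, by exact_mod_cast h⟩
  obtain ⟨E₂, hE₂⟩ := SqrtCriterion.exists_eq_four_mul hEℤ
  -- KF: the class law of `Θ_N`
  obtain ⟨E₁, hE₁⟩ := SqrtCriterion.exists_eq_four_mul (thetaClassLaw N)
  -- KA + KΘp: the Eisenstein congruence `c·G ≡ θ_T (mod 2)`
  have hKA : ∀ n : ℕ, ¬ 2 ∣ n → (Odd ((fun n => (W₀.LFunction n : ℤ)) n) ↔ ThetaPattern.LevelPattern N n) :=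
    fun n hn => KA W₀ x₀ hx n hn
  obtain ⟨D, hD⟩ := exists_eq_two_mul
    (pattern_congr (Gη := ThetaPattern.thetaPattern N) hc hKA (ThetaPattern.thetaPatternParity N hNodd hle2))
  -- Kalg: `P = Θ_N·Uℤ` satisfies the square criterion
  have hP := criterion_mul hE₁ hE₂ (by rw [← hD]; rfl)
  have hU1ℤ : constantCoeff Uℤ = 1 := by
    have h := congrArg constantCoeff hUℤ
    rw [hU1, ← coeff_zero_eq_constantCoeff_apply, coeff_map, coeff_zero_eq_constantCoeff_apply, eq_intCast,
      Int.cast_eq_one] at h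
    exact h
  have hP0 : constantCoeff (kummerThetaSeries N * Uℤ) = 1 := by
    rw [map_mul, constantCoeff_kummerThetaSeries, hU1ℤ, mul_one]
  -- K√: the integral square root
  obtain ⟨R₀, hR₀1, hR₀⟩ := SqrtCriterion.sqrtCriterion _ hP0 fun n => by
    rw [hP, C_four, coeff_C_mul]
    exact dvd_mul_right _ _
  refine ⟨R₀, hR₀1, ?_⟩
  rw [← hUℤ, ← map_mul, ← map_pow, hR₀]

end Summit.BirchSwinnertonDyer.BirchSwinnertonDyer.Theorems.DepletionAtTwo.KummerSigma.ThetaLaw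

end
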